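import Summits.ValiantsHypothesis.ValiantsHypothesis.Theorems.DepthWindowLeafTables
import Summits.ValiantsHypothesis.ValiantsHypothesis.Theorems.DepthWindowSparseTwoLevelGood
import Summits.ValiantsHypothesis.ValiantsHypothesis.Theorems.DepthWindowSumProdTwoLevelMul
import Mathlib.Data.Fintype.BigOperators
import HarnessLib

/-!
# Route `DepthWindow`, g8 — piece (iv): components of a product by a `ΣΠΣΠ` gadget two levels up

Piece (iv) of the `(2,3)` SLIVER LEMMA programme (lens-4 NODE-v8 §11–§12), UNFUSED form, fully
assembled: if operands `cmp l ε` into a homogeneous gate list `Ψ₀` compute the weight components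
`[U_l]_ε` (`l < t`, `ε ≤ d`) at product-depth `≤ D₀`, then ONE appended `Σ Π Σ Π` gadget of
product-depth `≤ D₀ + 2`, all of whose gates are weighted homogeneous, computes
`[U_0 ⋯ U_{t-1}]_e` (`e ≤ d`, `e ≤ a·b`, `1 ≤ b`), with
`O((e+1)·σ^{a+2}·a·σ^{b+1})` gates, `σ = (d+1)(t+1)` — the meet-in-the-middle count
(`a = b ≈ √e`: `σ^{O(√e)}`).

Assembly: the two-level jump formula restricted to good outer indices
(`weightedHomogeneousComponent_prod_eq_twoLevel_good`), outer indices numbered by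
`Fintype.equivFin`, inner fixed-endpoint paths numbered into a uniform range `Fin σ^{b+1}` and PADDED
with all-zero leaf tables (`leafTab`; `sum_fin_pad`), leaf / terminal tables from
`Theorems/DepthWindowLeafTables.lean`, fed to the generic builder `exists_append_sumProdSumProdMul`.
Nothing here bears on `VP ≠ VNP`.

[cite: LimayeSrinivasanTavenas2025, Lemma 11] [cite: Burgisser2000, Def. 2.1]
-/

set_option linter.dupNamespace false

namespace Summit.ValiantsHypothesis.ValiantsHypothesis.Theorems.DepthWindow

open Finset MvPolynomial Literature.Computability.AlgebraicComplexity ArithCircuit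

/-- States of the jump automaton: (degree reached, position). -/
abbrev StT (d t : ℕ) : Type := Fin (d + 1) × Fin (t + 1)

/-- Outer indices of the fixed-endpoint two-level formula: (jump count, end state, outer path). -/
abbrev Outer (d t e a : ℕ) : Type :=
  Fin (e + 1) × ((y : StT d t) × PathsFix (StT d t) a (((0 : Fin (d + 1)), (0 : Fin (t + 1))) : StT d t) y)

/-- Good outer indices: terminal degree `e`, stepwise monotone degree. -/
abbrev GoodT (d t e a : ℕ) : Type :=
  {α : Outer d t e a // ((α.2.1.1 : ℕ) = e) ∧
    ∀ q : Fin a, ((α.2.2.1 q.castSucc).1 : ℕ) ≤ (α.2.2.1 q.succ).1}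

/-- Padding a sum over a numbered finite type into a uniform range. -/
theorem sum_fin_pad {M : Type*} [AddCommMonoid M] {F : Type*} [Fintype F] [DecidableEq F] (nB : ℕ)
    (h : Fintype.card F ≤ nB) (f : F → M) :
    ∑ β : Fin nB, (if hβ : (β : ℕ) < Fintype.card F then f ((Fintype.equivFin F).symm ⟨β, hβ⟩) else 0)
      = ∑ s, f s := by
  rw [Fin.sum_univ_eq_sum_range
      (fun i => if hβ : i < Fintype.card F then f ((Fintype.equivFin F).symm ⟨i, hβ⟩) else 0) nB,
    ← Finset.sum_range_add_sum_Ico _ h,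
    Finset.sum_eq_zero (s := Finset.Ico (Fintype.card F) nB) (fun i hi => by
      rw [Finset.mem_Ico] at hi; exact dif_neg (by omega)), add_zero,
    ← Fin.sum_univ_eq_sum_range
      (fun i => if hβ : i < Fintype.card F then f ((Fintype.equivFin F).symm ⟨i, hβ⟩) else 0)]
  exact Fintype.sum_equiv (Fintype.equivFin F).symm _ f fun β => by simp only [dif_pos β.isLt]

/-- Good outer indices vs the filtered sum. -/
theorem sum_goodT_eq_sum_filter {M : Type*} [AddCommMonoid M] (d t e a : ℕ) (F : Outer d t e a → M) :
    ∑ g : GoodT d t e a, F g.1 =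
      ∑ α ∈ (Finset.univ : Finset (Outer d t e a)).filter
          (fun α => ((α.2.1.1 : ℕ) = e) ∧
            ∀ q : Fin a, ((α.2.2.1 q.castSucc).1 : ℕ) ≤ (α.2.2.1 q.succ).1), F α := by
  rw [← Finset.sum_subtype_eq_sum_filter, Finset.subtype_univ]

/-- Counting the outer indices: `card GoodT ≤ (e+1)·σ^{a+2}`. -/
theorem card_goodT_le (d t e a : ℕ) :
    Fintype.card (GoodT d t e a) ≤ (e + 1) * ((d + 1) * (t + 1)) ^ (a + 2) := by
  refine (Fintype.card_subtype_le _).trans ?_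
  rw [Fintype.card_prod, Fintype.card_fin, Fintype.card_sigma]
  refine Nat.mul_le_mul_left _ ?_
  calc ∑ y : StT d t, Fintype.card (PathsFix (StT d t) a (((0 : Fin (d + 1)), (0 : Fin (t + 1))) : StT d t) y)
      ≤ ∑ _y : StT d t, ((d + 1) * (t + 1)) ^ (a + 1) :=
        Finset.sum_le_sum fun y _ => (Fintype.card_subtype_le _).trans (le_of_eq (by
          rw [Fintype.card_fun, Fintype.card_prod, Fintype.card_fin, Fintype.card_fin, Fintype.card_fin]))
    _ = ((d + 1) * (t + 1)) ^ (a + 2) := by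
        rw [Finset.sum_const, Finset.card_univ, Fintype.card_prod, Fintype.card_fin, Fintype.card_fin,
          smul_eq_mul]
        ring

/-- Counting the inner indices: `card PathsFix ≤ σ^{b+1}`. -/
theorem card_pathsFix_le (d t b : ℕ) (x y : StT d t) :
    Fintype.card (PathsFix (StT d t) b x y) ≤ ((d + 1) * (t + 1)) ^ (b + 1) :=
  (Fintype.card_subtype_le _).trans (le_of_eq (by
    rw [Fintype.card_fun, Fintype.card_prod, Fintype.card_fin, Fintype.card_fin, Fintype.card_fin]))

variable {k : Type*} [CommRing k] {τ : Type*}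

/-- The padded leaf table of block `q` of the good outer index `g`: inner slot `β < card` = the
leaf table of the `β`-th fixed-endpoint inner path, other slots all-zero. -/
noncomputable def leafTab (d t : ℕ) (cmp : ℕ → ℕ → Operand k τ) (e a b nB : ℕ) (g : GoodT d t e a)
    (q : Fin a) (β : Fin nB) (u' : Fin (b * (t + 1))) : Operand k τ :=
  if hβ : (β : ℕ) < Fintype.card (PathsFix (StT d t) b (g.1.2.2.1 q.castSucc) (g.1.2.2.1 q.succ)) then
    leafOp d t cmp (g.1.1 : ℕ) a b q
      ((Fintype.equivFin (PathsFix (StT d t) b (g.1.2.2.1 q.castSucc) (g.1.2.2.1 q.succ))).symm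
        ⟨β, hβ⟩).1 u'
  else Operand.const 0

section LeafTab

variable (w : τ → ℕ) (d t : ℕ) (U : ℕ → MvPolynomial τ k) (cmp : ℕ → ℕ → Operand k τ)
  (V : List (MvPolynomial τ k)) (D : List ℕ) (n D₀ : ℕ) (e a b nB : ℕ)

/-- References of the padded leaf table. -/
theorem leafTab_refsBelow (hrefs : ∀ l ε, l < t → ε ≤ d → (cmp l ε).RefsBelow n)
    (g : GoodT d t e a) (q : Fin a) (β : Fin nB) (u' : Fin (b * (t + 1))) :
    (leafTab d t cmp e a b nB g q β u').RefsBelow n := by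
  unfold leafTab
  by_cases hβ : (β : ℕ) < Fintype.card (PathsFix (StT d t) b (g.1.2.2.1 q.castSucc) (g.1.2.2.1 q.succ))
  · rw [dif_pos hβ]; exact leafOp_refsBelow d t cmp _ hrefs _ a b q _ u'
  · rw [dif_neg hβ]; trivial

/-- Depth of the padded leaf table. -/
theorem leafTab_depthIn (hdp : ∀ l ε, l < t → ε ≤ d → (cmp l ε).depthIn D ≤ D₀)
    (g : GoodT d t e a) (q : Fin a) (β : Fin nB) (u' : Fin (b * (t + 1))) :
    (leafTab d t cmp e a b nB g q β u').depthIn D ≤ D₀ := by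
  unfold leafTab
  by_cases hβ : (β : ℕ) < Fintype.card (PathsFix (StT d t) b (g.1.2.2.1 q.castSucc) (g.1.2.2.1 q.succ))
  · rw [dif_pos hβ]; exact leafOp_depthIn d t cmp _ D₀ hdp _ a b q _ u'
  · rw [dif_neg hβ]; exact Nat.zero_le _

/-- Weight of the padded leaf products: the degree increment of block `q`. -/
theorem prod_leafTab_isWeightedHomogeneous
    (hev : ∀ l ε, l < t → ε ≤ d → (cmp l ε).eval V = weightedHomogeneousComponent w ε (U l))
    (hpos : 0 < b * (t + 1)) (g : GoodT d t e a) (q : Fin a) (β : Fin nB) :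
    IsWeightedHomogeneous w (∏ u' : Fin (b * (t + 1)), (leafTab d t cmp e a b nB g q β u').eval V)
      (((g.1.2.2.1 q.succ).1 : ℕ) - (g.1.2.2.1 q.castSucc).1) := by
  unfold leafTab
  by_cases hβ : (β : ℕ) < Fintype.card (PathsFix (StT d t) b (g.1.2.2.1 q.castSucc) (g.1.2.2.1 q.succ))
  · simp only [dif_pos hβ]
    set s := (Fintype.equivFin
      (PathsFix (StT d t) b (g.1.2.2.1 q.castSucc) (g.1.2.2.1 q.succ))).symm ⟨β, hβ⟩ with hs
    have h := prod_leafOp_isWeightedHomogeneous w d t U cmp V hev (g.1.1 : ℕ) a b q s.1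
    have h0 : s.1 0 = g.1.2.2.1 q.castSucc := s.2.1
    have h1 : s.1 (Fin.last b) = g.1.2.2.1 q.succ := s.2.2
    rw [h0, h1] at h
    exact h
  · simp only [dif_neg hβ]
    rw [Finset.prod_eq_zero (Finset.mem_univ (⟨0, hpos⟩ : Fin (b * (t + 1))))
      (by simp only [Operand.eval, C_0])]
    exact isWeightedHomogeneous_zero k w _

/-- Value of the padded inner sums: the fixed-endpoint inner path sum of block `q`. -/
theorem sum_prod_leafTab_eval
    (hev : ∀ l ε, l < t → ε ≤ d → (cmp l ε).eval V = weightedHomogeneousComponent w ε (U l))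
    (hpos : 0 < b * (t + 1)) (g : GoodT d t e a) (q : Fin a) :
    ∑ β : Fin (((d + 1) * (t + 1)) ^ (b + 1)),
        ∏ u' : Fin (b * (t + 1)),
          (leafTab d t cmp e a b (((d + 1) * (t + 1)) ^ (b + 1)) g q β u').eval V =
      ∑ s : PathsFix (StT d t) b (g.1.2.2.1 q.castSucc) (g.1.2.2.1 q.succ),
        pathWeight (fun u : Fin b =>
          padLayers (jumpMat w d t U) (g.1.1 : ℕ) (a * b) ⟨(q : ℕ) * b + u, blockIndex_lt q u⟩) s.1 := by
  rw [← sum_fin_pad (((d + 1) * (t + 1)) ^ (b + 1)) (card_pathsFix_le d t b _ _)]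
  refine Finset.sum_congr rfl fun β _ => ?_
  unfold leafTab
  by_cases hβ : (β : ℕ) < Fintype.card (PathsFix (StT d t) b (g.1.2.2.1 q.castSucc) (g.1.2.2.1 q.succ))
  · simp only [dif_pos hβ]
    exact prod_leafOp_eval w d t U cmp V hev _ a b q _
  · simp only [dif_neg hβ]
    exact Finset.prod_eq_zero (Finset.mem_univ (⟨0, hpos⟩ : Fin (b * (t + 1))))
      (by simp only [Operand.eval, C_0])

end LeafTab

/-- **Piece (iv), unfused: the weight-`e` component of a product of `t` factors whose components
sit at product-depth `≤ D₀` is computed by an appended homogeneous `Σ Π Σ Π` gadget of product-depth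
`≤ D₀ + 2`.** [cite: LimayeSrinivasanTavenas2025, Lemma 11] -/
theorem exists_gates_prod_component (w : τ → ℕ) (Ψ₀ : List (Gate k τ)) (d t e a b D₀ : ℕ)
    (he : e ≤ d) (hab : e ≤ a * b) (hb : 1 ≤ b) (U : ℕ → MvPolynomial τ k)
    (cmp : ℕ → ℕ → Operand k τ)
    (hrefs : ∀ l ε, l < t → ε ≤ d → (cmp l ε).RefsBelow Ψ₀.length)
    (hdp : ∀ l ε, l < t → ε ≤ d → (cmp l ε).depthIn (gateWDepths prodWeight Ψ₀) ≤ D₀)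
    (hev : ∀ l ε, l < t → ε ≤ d →
      (cmp l ε).eval (gateValues Ψ₀) = weightedHomogeneousComponent w ε (U l))
    (hhom₀ : ∀ g ∈ gateValues Ψ₀, ∃ e' : ℕ, IsWeightedHomogeneous w g e') :
    ∃ (Δ : List (Gate k τ)) (o : Operand k τ),
      Δ.length ≤ ((e + 1) * ((d + 1) * (t + 1)) ^ (a + 2) + 1) *
          (a * (((d + 1) * (t + 1)) ^ (b + 1) + 1) + 1) ∧
      (∀ vs : List (Operand k τ), Gate.prod vs ∈ Δ →
          vs.length = b * (t + 1) ∨ vs.length = a + (t + 1)) ∧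
      (∀ g ∈ gateValues (Ψ₀ ++ Δ), ∃ e' : ℕ, IsWeightedHomogeneous w g e') ∧
      (∀ y ∈ gateWDepths prodWeight (Ψ₀ ++ Δ), y ∈ gateWDepths prodWeight Ψ₀ ∨ y ≤ D₀ + 2) ∧
      o.RefsBelow (Ψ₀ ++ Δ).length ∧
      o.depthIn (gateWDepths prodWeight (Ψ₀ ++ Δ)) ≤ D₀ + 2 ∧
      IsWeightedHomogeneous w (o.eval (gateValues (Ψ₀ ++ Δ))) e ∧
      o.eval (gateValues (Ψ₀ ++ Δ)) = weightedHomogeneousComponent w e (∏ l ∈ range t, U l) := by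
  have hpos : 0 < b * (t + 1) := Nat.mul_pos (by omega) (Nat.succ_pos t)
  obtain ⟨Δ, o, hlen, hfan, hhom, hdepths, horefs, hodp, hoW, hoval⟩ :=
    exists_append_sumProdSumProdMul w (nA := Fintype.card (GoodT d t e a))
      (nB := ((d + 1) * (t + 1)) ^ (b + 1)) (a := a) (b := b * (t + 1)) (x := t + 1) Ψ₀
      (fun _ => (1 : k)) (fun _ _ _ => (1 : k))
      (fun i q β u' => leafTab d t cmp e a b (((d + 1) * (t + 1)) ^ (b + 1))
        ((Fintype.equivFin (GoodT d t e a)).symm i) q β u')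
      (fun i v => finFactorOp d t e cmp ((Fintype.equivFin (GoodT d t e a)).symm i).1.2.1 v)
      D₀ e
      (fun i q => ((((Fintype.equivFin (GoodT d t e a)).symm i).1.2.2.1 q.succ).1 : ℕ) -
        (((Fintype.equivFin (GoodT d t e a)).symm i).1.2.2.1 q.castSucc).1)
      (fun _ => 0)
      (fun i q β u' => leafTab_refsBelow d t cmp _ e a b _ hrefs _ q β u')
      (fun i q β u' => leafTab_depthIn d t cmp _ D₀ e a b _ hdp _ q β u')
      (fun i v => finFactorOp_refsBelow d t cmp _ e hrefs _ v)
      (fun i v => (finFactorOp_depthIn d t cmp _ D₀ e hdp _ v).trans (Nat.le_succ _))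
      hhom₀
      (fun i q β => prod_leafTab_isWeightedHomogeneous w d t U cmp (gateValues Ψ₀) e a b _ hev hpos _ q β)
      (fun i => prod_finFactorOp_isWeightedHomogeneous w d t U cmp (gateValues Ψ₀) e hev _)
      (fun i => by
        rw [add_zero]
        exact sum_blockWt_eq_of_good e ((Fintype.equivFin (GoodT d t e a)).symm i).1
          ((Fintype.equivFin (GoodT d t e a)).symm i).2.1 ((Fintype.equivFin (GoodT d t e a)).symm i).2.2)
  refine ⟨Δ, o, ?_, hfan, hhom, hdepths, horefs, hodp, hoW, ?_⟩
  · -- the count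
    rw [hlen]
    have hA := card_goodT_le d t e a
    have h1 : (Fintype.card (GoodT d t e a) + 1) * (a * (((d + 1) * (t + 1)) ^ (b + 1) + 1) + 1) =
        Fintype.card (GoodT d t e a) * a * (((d + 1) * (t + 1)) ^ (b + 1) + 1) +
          (Fintype.card (GoodT d t e a) + 1) + a * (((d + 1) * (t + 1)) ^ (b + 1) + 1) := by ring
    calc Fintype.card (GoodT d t e a) * a * (((d + 1) * (t + 1)) ^ (b + 1) + 1) +
          (Fintype.card (GoodT d t e a) + 1)
        ≤ (Fintype.card (GoodT d t e a) + 1) * (a * (((d + 1) * (t + 1)) ^ (b + 1) + 1) + 1) := by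
          rw [h1]; omega
      _ ≤ ((e + 1) * ((d + 1) * (t + 1)) ^ (a + 2) + 1) * (a * (((d + 1) * (t + 1)) ^ (b + 1) + 1) + 1) :=
          Nat.mul_le_mul_right _ (by omega)
  · -- the value
    rw [hoval]
    simp only [C_1, one_mul, sum_prod_leafTab_eval w d t U cmp (gateValues Ψ₀) e a b hev hpos,
      prod_finFactorOp_eval w d t U cmp (gateValues Ψ₀) e hev]
    rw [weightedHomogeneousComponent_prod_eq_twoLevel_good w d t e a b he hab U,
      ← sum_goodT_eq_sum_filter]
    exact Fintype.sum_equiv (Fintype.equivFin (GoodT d t e a)).symm _ _ fun i => mul_comm _ _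

end Summit.ValiantsHypothesis.ValiantsHypothesis.Theorems.DepthWindow
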